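import Literature.GroupTheory.CombinatorialGroupTheory.RandomSclFreeGroupPairingBound
import HarnessLib

/-!
# Random rigidity of scl (Calegari–Walker 2013): proofs, part 30 — runs and partner runs of a
pairing, in permutation form

D. Calegari, A. Walker, *Random rigidity in the free group*, Geom. Topol. 17 (2013)
[CalegariWalker2013], §4.4: the fatgraph of a pairing `π` of a cyclic word of length `N` has
vertices the orbits of `τ = π ∘ σ` (`σ = finRotate N` the cyclic shift, `τ x = π (x + 1)`), the
corner `x` sitting between the letters `x` and `x + 1`; a corner is *bivalent* (interior to an edge)
iff `τ² x = x`, and *big* otherwise. The maximal run of letters leaving a big corner `x` —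
`σ x, σ² x, …, σ^g x` with `σ x, …, σ^{g−1} x` bivalent and `σ^g x` big — is one side of an edge;
the other side is the run ARRIVING at the corner `τ x`: its letters are
`π (σ^j x) = σ^{−(j−1)} (τ x)`, its interior corners `σ^{−j} (τ x)` (`1 ≤ j ≤ g − 1`) are bivalent,
its start corner `z = σ^{−g} (τ x)` is big, and `τ z = σ^g x`. All of this is permutation algebra.

* **`pairing_pow_shift`** — `π (σ^j x) = σ^{−(j−1)} (τ x)` along a run.
* **`bivalent_partner_corner`** — the interior corners of the partner run are bivalent.
* **`tau_partner_start`** — `τ (σ^{−g} (τ x)) = σ^g x`.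
* **`big_partner_start`** — the start corner of the partner run is big.
* **`exists_gap`**, **`gap_unique`**, **`gap_partner`** — the gap (edge length) of a big corner.
* **`exists_big_corner`** — a cyclically reduced word with a pairing has a big corner.
-/

noncomputable section

namespace Literature.GroupTheory.CombinatorialGroupTheory

section BigCorners

open Equiv

/-- Bivalence of the corner `c` in terms of `π`: `τ (τ c) = c ↔ σ (π (σ c)) = π c` for an
involution `π` (`τ = σ.trans π`). [folklore] -/
theorem bivalent_iff {N : ℕ} (π : Equiv.Perm (Fin N)) (hπ : ∀ y, π (π y) = y) (c : Fin N) :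
    ((finRotate N).trans π) (((finRotate N).trans π) c) = c ↔
      (finRotate N) (π ((finRotate N) c)) = π c := by
  simp only [Equiv.trans_apply]
  constructor
  · intro h
    have := congrArg π h
    rwa [hπ] at this
  · intro h
    have := congrArg π h
    rwa [hπ] at this

/-- **The partners along a run descend.** If the corners `σ x, …, σ^{g−1} x` are bivalent, then
`π (σ^j x) = σ^{−(j−1)} (τ x)` for `1 ≤ j ≤ g`. [cite: CalegariWalker2013, §4.4] -/
theorem pairing_pow_shift {N : ℕ} (π : Equiv.Perm (Fin N)) (hπ : ∀ y, π (π y) = y) (x : Fin N)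
    (g : ℕ) (hbiv : ∀ j, 1 ≤ j → j ≤ g - 1 →
      ((finRotate N).trans π) (((finRotate N).trans π) (((finRotate N) ^ j) x)) = ((finRotate N) ^ j) x)
    (j : ℕ) (hj1 : 1 ≤ j) (hjg : j ≤ g) :
    π (((finRotate N) ^ j) x) = ((finRotate N).symm ^ (j - 1)) (((finRotate N).trans π) x) := by
  induction j with
  | zero => omega
  | succ j ih =>
    rcases Nat.eq_zero_or_pos j with hj0 | hj0
    · subst hj0
      simp [Equiv.trans_apply]
    · have ih' := ih hj0 (by omega)
      have hb := hbiv j hj0 (by omega)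
      rw [bivalent_iff π hπ] at hb
      -- `σ (π (σ (σ^j x))) = π (σ^j x)`
      have e1 : ((finRotate N) ^ (j + 1)) x = (finRotate N) (((finRotate N) ^ j) x) := by
        rw [pow_succ', Equiv.Perm.mul_apply]
      rw [e1]
      apply (finRotate N).injective
      rw [hb, ih', show j + 1 - 1 = (j - 1) + 1 by omega, pow_succ', Equiv.Perm.mul_apply,
        Equiv.apply_symm_apply]

/-- **The interior corners of the partner run are bivalent.** Under the same hypothesis, the
corners `σ^{−j} (τ x)` for `1 ≤ j ≤ g − 1` are bivalent. [cite: CalegariWalker2013, §4.4] -/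
theorem bivalent_partner_corner {N : ℕ} (π : Equiv.Perm (Fin N)) (hπ : ∀ y, π (π y) = y)
    (x : Fin N) (g : ℕ) (hbiv : ∀ j, 1 ≤ j → j ≤ g - 1 →
      ((finRotate N).trans π) (((finRotate N).trans π) (((finRotate N) ^ j) x)) = ((finRotate N) ^ j) x)
    (j : ℕ) (hj1 : 1 ≤ j) (hjg : j ≤ g - 1) :
    ((finRotate N).trans π) (((finRotate N).trans π)
      (((finRotate N).symm ^ j) (((finRotate N).trans π) x))) =
      ((finRotate N).symm ^ j) (((finRotate N).trans π) x) := by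
  set σ := finRotate N with hσ
  set τ := σ.trans π with hτ
  rw [bivalent_iff π hπ]
  -- `σ (σ⁻ʲ (τ x)) = σ^{-(j-1)} (τ x) = π (σ^j x)`
  have h1 : σ ((σ.symm ^ j) (τ x)) = (σ.symm ^ (j - 1)) (τ x) := by
    rw [show j = (j - 1) + 1 by omega, pow_succ', Equiv.Perm.mul_apply, Equiv.apply_symm_apply,
      show j - 1 + 1 - 1 = j - 1 by omega]
  have h2 : (σ.symm ^ (j - 1)) (τ x) = π ((σ ^ j) x) :=
    (pairing_pow_shift π hπ x g hbiv j hj1 (by omega)).symm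
  have h3 : (σ.symm ^ j) (τ x) = π ((σ ^ (j + 1)) x) := by
    rw [pairing_pow_shift π hπ x g hbiv (j + 1) (by omega) (by omega), Nat.add_sub_cancel]
  rw [h1, h2, hπ, h3, hπ, pow_succ', Equiv.Perm.mul_apply]

/-- **The start corner of the partner run maps to the end corner of the run.**
`τ (σ^{−g} (τ x)) = σ^g x`. [cite: CalegariWalker2013, §4.4] -/
theorem tau_partner_start {N : ℕ} (π : Equiv.Perm (Fin N)) (hπ : ∀ y, π (π y) = y) (x : Fin N)
    (g : ℕ) (hg : 1 ≤ g) (hbiv : ∀ j, 1 ≤ j → j ≤ g - 1 →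
      ((finRotate N).trans π) (((finRotate N).trans π) (((finRotate N) ^ j) x)) = ((finRotate N) ^ j) x) :
    ((finRotate N).trans π) (((finRotate N).symm ^ g) (((finRotate N).trans π) x)) =
      ((finRotate N) ^ g) x := by
  set σ := finRotate N with hσ
  rw [Equiv.trans_apply]
  have h1 : σ ((σ.symm ^ g) ((σ.trans π) x)) = (σ.symm ^ (g - 1)) ((σ.trans π) x) := by
    rw [show g = (g - 1) + 1 by omega, pow_succ', Equiv.Perm.mul_apply, Equiv.apply_symm_apply,
      show g - 1 + 1 - 1 = g - 1 by omega]
  rw [h1, ← pairing_pow_shift π hπ x g hbiv g hg le_rfl, hπ]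

/-- **The start corner of the partner run is big** (if the end corner `σ^g x` of the run is big).
[cite: CalegariWalker2013, §4.4] -/
theorem big_partner_start {N : ℕ} (π : Equiv.Perm (Fin N)) (hπ : ∀ y, π (π y) = y) (x : Fin N)
    (g : ℕ) (hg : 1 ≤ g) (hbiv : ∀ j, 1 ≤ j → j ≤ g - 1 →
      ((finRotate N).trans π) (((finRotate N).trans π) (((finRotate N) ^ j) x)) = ((finRotate N) ^ j) x)
    (hbig : ((finRotate N).trans π) (((finRotate N).trans π) (((finRotate N) ^ g) x)) ≠
      ((finRotate N) ^ g) x) :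
    ((finRotate N).trans π) (((finRotate N).trans π)
      (((finRotate N).symm ^ g) (((finRotate N).trans π) x))) ≠
      ((finRotate N).symm ^ g) (((finRotate N).trans π) x) := by
  set σ := finRotate N with hσ
  set τ := σ.trans π with hτ
  set z := (σ.symm ^ g) (τ x) with hz
  set x' := (σ ^ g) x with hx'
  have htz : τ z = x' := tau_partner_start π hπ x g hg hbiv
  intro hbz
  apply hbig
  -- `τ (τ z) = z` means `τ x' = z`, i.e. `π (σ x') = z`; then the corner `x'` is bivalent
  rw [htz] at hbz
  -- bivalence of `x'`: `σ (π (σ x')) = π x'`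
  show τ (τ x') = x'
  rw [bivalent_iff π hπ]
  have h1 : π (σ x') = z := hbz
  have h2 : π x' = (σ.symm ^ (g - 1)) (τ x) := pairing_pow_shift π hπ x g hbiv g hg le_rfl
  rw [h1, h2, hz, show g = (g - 1) + 1 by omega, pow_succ', Equiv.Perm.mul_apply,
    Equiv.apply_symm_apply, show g - 1 + 1 - 1 = g - 1 by omega]

/-- Values of powers of the cyclic shift: `(σ^k x : ℕ) = (x + k) % N`. [folklore] -/
theorem val_finRotate_pow {N : ℕ} (hN : 0 < N) (x : Fin N) (k : ℕ) :
    ((((finRotate N) ^ k) x : Fin N) : ℕ) = ((x : ℕ) + k) % N := by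
  induction k with
  | zero => simp [Nat.mod_eq_of_lt x.2]
  | succ k ih =>
    rw [pow_succ', Equiv.Perm.mul_apply, val_finRotate hN, ih, Nat.mod_add_mod, Nat.add_assoc]

/-- `σ^N = 1` pointwise. [folklore] -/
theorem finRotate_pow_self_apply {N : ℕ} (hN : 0 < N) (x : Fin N) : ((finRotate N) ^ N) x = x := by
  apply Fin.ext
  rw [val_finRotate_pow hN, Nat.add_mod_right, Nat.mod_eq_of_lt x.2]

/-- `σ^j (σ⁻ʲ w) = w`. [folklore] -/
theorem pow_apply_symm_pow_self {N : ℕ} (j : ℕ) (w : Fin N) :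
    ((finRotate N) ^ j) (((finRotate N).symm ^ j) w) = w := by
  induction j generalizing w with
  | zero => simp
  | succ j ih =>
    rw [pow_succ, Equiv.Perm.mul_apply, pow_succ', Equiv.Perm.mul_apply, Equiv.apply_symm_apply,
      ih]

/-- `σ^{j} (σ⁻ᵍ y) = σ⁻^{(g - j)} y` for `j ≤ g`. [folklore] -/
theorem pow_apply_symm_pow {N : ℕ} (y : Fin N) {j g : ℕ} (hj : j ≤ g) :
    ((finRotate N) ^ j) (((finRotate N).symm ^ g) y) = ((finRotate N).symm ^ (g - j)) y := by
  have : g = j + (g - j) := by omega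
  conv_lhs => rw [this, pow_add, Equiv.Perm.mul_apply]
  exact pow_apply_symm_pow_self j _

/-- **Gaps exist.** For a corner `x` and `N ≥ 1` there is `g` with `1 ≤ g ≤ N`, the corners
`σ x, …, σ^{g−1} x` bivalent and `σ^g x` big — provided `x` itself is big (take the least `g ≥ 1`
with `σ^g x` big; `g = N` qualifies as `σ^N x = x`). [folklore] -/
theorem exists_gap {N : ℕ} (hN : 0 < N) (τ : Equiv.Perm (Fin N)) (x : Fin N) (hx : τ (τ x) ≠ x) :
    ∃ g, 1 ≤ g ∧ g ≤ N ∧ (∀ j, 1 ≤ j → j ≤ g - 1 → τ (τ (((finRotate N) ^ j) x)) = ((finRotate N) ^ j) x) ∧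
      τ (τ (((finRotate N) ^ g) x)) ≠ ((finRotate N) ^ g) x := by
  classical
  have hex : ∃ g, 1 ≤ g ∧ τ (τ (((finRotate N) ^ g) x)) ≠ ((finRotate N) ^ g) x :=
    ⟨N, hN, by rw [finRotate_pow_self_apply hN]; exact hx⟩
  refine ⟨Nat.find hex, (Nat.find_spec hex).1, ?_, ?_, (Nat.find_spec hex).2⟩
  · exact Nat.find_min' hex ⟨hN, by rw [finRotate_pow_self_apply hN]; exact hx⟩
  · intro j hj1 hjg
    by_contra h
    exact Nat.find_min hex (show j < Nat.find hex by omega) ⟨hj1, h⟩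

/-- **Gaps are unique.** [folklore] -/
theorem gap_unique {N : ℕ} (τ : Equiv.Perm (Fin N)) (x : Fin N) {g g' : ℕ} (hg : 1 ≤ g)
    (hbiv : ∀ j, 1 ≤ j → j ≤ g - 1 → τ (τ (((finRotate N) ^ j) x)) = ((finRotate N) ^ j) x)
    (hbig : τ (τ (((finRotate N) ^ g) x)) ≠ ((finRotate N) ^ g) x) (hg' : 1 ≤ g')
    (hbiv' : ∀ j, 1 ≤ j → j ≤ g' - 1 → τ (τ (((finRotate N) ^ j) x)) = ((finRotate N) ^ j) x)
    (hbig' : τ (τ (((finRotate N) ^ g') x)) ≠ ((finRotate N) ^ g') x) : g = g' := by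
  by_contra hne
  rcases Nat.lt_or_gt_of_ne hne with h | h
  · exact hbig (hbiv' g hg (by omega))
  · exact hbig' (hbiv g' hg' (by omega))

/-- **The partner run has the same gap.** If `x` is big with gap `g` (for `τ = σ.trans π`, `π` an
involution), then the start corner `z = σ^{−g} (τ x)` of the partner run has gap `g` as well:
`σ z, …, σ^{g−1} z` are bivalent and `σ^g z = τ x` is big. [cite: CalegariWalker2013, §4.4] -/
theorem gap_partner {N : ℕ} (π : Equiv.Perm (Fin N)) (hπ : ∀ y, π (π y) = y) (x : Fin N) (g : ℕ)
    (hg : 1 ≤ g) (hx : ((finRotate N).trans π) (((finRotate N).trans π) x) ≠ x)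
    (hbiv : ∀ j, 1 ≤ j → j ≤ g - 1 →
      ((finRotate N).trans π) (((finRotate N).trans π) (((finRotate N) ^ j) x)) = ((finRotate N) ^ j) x) :
    (∀ j, 1 ≤ j → j ≤ g - 1 →
      ((finRotate N).trans π) (((finRotate N).trans π)
        (((finRotate N) ^ j) (((finRotate N).symm ^ g) (((finRotate N).trans π) x)))) =
        ((finRotate N) ^ j) (((finRotate N).symm ^ g) (((finRotate N).trans π) x))) ∧
    ((finRotate N) ^ g) (((finRotate N).symm ^ g) (((finRotate N).trans π) x)) =
      ((finRotate N).trans π) x ∧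
    ((finRotate N).trans π) (((finRotate N).trans π) (((finRotate N).trans π) x)) ≠
      ((finRotate N).trans π) x := by
  set σ := finRotate N with hσ
  set τ := σ.trans π with hτ
  refine ⟨?_, ?_, ?_⟩
  · intro j hj1 hjg
    rw [pow_apply_symm_pow _ (by omega : j ≤ g)]
    exact bivalent_partner_corner π hπ x g hbiv (g - j) (by omega) (by omega)
  · rw [pow_apply_symm_pow _ le_rfl, Nat.sub_self, pow_zero, Equiv.Perm.one_apply]
  · intro h
    exact hx (τ.injective h)

/-- **Big corners exist.** For a pairing `π` of a non-empty cyclically reduced word `W`, some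
corner is big: otherwise `π` would be an affine reflection `x ↦ c − x` of the cycle, forcing a fixed
point of `π` (`c` even) or two adjacent mutually inverse letters (`c` odd).
[cite: CalegariWalker2013, §4.4 (the fatgraph has a vertex)] -/
theorem exists_big_corner {α : Type*} [DecidableEq α] (W : List (α × Bool)) (hW0 : W ≠ [])
    (hW : FreeGroup.IsCyclicallyReduced W) (π : Equiv.Perm (Fin W.length)) (hπ : IsPairing W π) :
    ∃ x : Fin W.length, ((finRotate W.length).trans π) (((finRotate W.length).trans π) x) ≠ x := by
  have hN : 0 < W.length := List.length_pos_of_ne_nil hW0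
  by_contra hall
  push Not at hall
  -- all corners bivalent: `π (σ^k c) = σ^{-(k-1)} (τ c)` for all `k ≥ 1`, with `c = 0`
  have hbiv : ∀ (g j : ℕ), 1 ≤ j → j ≤ g - 1 → ((finRotate W.length).trans π)
      (((finRotate W.length).trans π) (((finRotate W.length) ^ j) (⟨0, hN⟩ : Fin W.length))) =
      ((finRotate W.length) ^ j) (⟨0, hN⟩ : Fin W.length) :=
    fun g j _ _ => hall _
  have hshift : ∀ k, 1 ≤ k → π (((finRotate W.length) ^ k) ⟨0, hN⟩) =
      ((finRotate W.length).symm ^ (k - 1)) (((finRotate W.length).trans π) ⟨0, hN⟩) :=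
    fun k hk => pairing_pow_shift π hπ.1 ⟨0, hN⟩ (k + 1) (hbiv (k + 1)) k hk (by omega)
  -- values
  have hpN : ((((finRotate W.length).trans π) ⟨0, hN⟩ : Fin W.length) : ℕ) < W.length :=
    (((finRotate W.length).trans π) ⟨0, hN⟩).2
  have hval : ∀ k, 1 ≤ k → k ≤ ((((finRotate W.length).trans π) ⟨0, hN⟩ : Fin W.length) : ℕ) + 1 →
      ((π (((finRotate W.length) ^ k) ⟨0, hN⟩) : Fin W.length) : ℕ) + (k - 1) =
        ((((finRotate W.length).trans π) ⟨0, hN⟩ : Fin W.length) : ℕ) := by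
    intro k hk hkp
    have h1 := hshift k hk
    have h2 : ((finRotate W.length) ^ (k - 1)) (π (((finRotate W.length) ^ k) ⟨0, hN⟩)) =
        ((finRotate W.length).trans π) ⟨0, hN⟩ := by
      rw [h1]
      exact pow_apply_symm_pow_self (k - 1) _
    have h3 := congrArg Fin.val h2
    rw [val_finRotate_pow hN] at h3
    have hlt : ((π (((finRotate W.length) ^ k) ⟨0, hN⟩) : Fin W.length) : ℕ) < W.length :=
      (π (((finRotate W.length) ^ k) ⟨0, hN⟩)).2
    rcases Nat.lt_or_ge (((π (((finRotate W.length) ^ k) ⟨0, hN⟩) : Fin W.length) : ℕ) + (k - 1))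
      W.length with h | h
    · rw [Nat.mod_eq_of_lt h] at h3; exact h3
    · exfalso
      have h5 : (((π (((finRotate W.length) ^ k) ⟨0, hN⟩) : Fin W.length) : ℕ) + (k - 1)) % W.length =
          ((π (((finRotate W.length) ^ k) ⟨0, hN⟩) : Fin W.length) : ℕ) + (k - 1) - W.length := by
        rw [Nat.mod_eq_sub_mod h, Nat.mod_eq_of_lt (by omega)]
      omega
  have hck : ∀ k, k < W.length → ((((finRotate W.length) ^ k) ⟨0, hN⟩ : Fin W.length) : ℕ) = k := by
    intro k hk
    rw [val_finRotate_pow hN]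
    show (0 + k) % W.length = k
    rw [Nat.zero_add, Nat.mod_eq_of_lt hk]
  rcases Nat.even_or_odd ((((finRotate W.length).trans π) ⟨0, hN⟩ : Fin W.length) : ℕ) with
    ⟨m, hm⟩ | ⟨m, hm⟩
  · -- `p = 2m`: `π (σ^{m+1} 0) = m` and `σ^{m+1} 0 = m + 1`: adjacent letters cancel
    have hk := hval (m + 1) (by omega) (by omega)
    rw [Nat.add_sub_cancel] at hk
    have hpi : ((π (((finRotate W.length) ^ (m + 1)) ⟨0, hN⟩) : Fin W.length) : ℕ) = m := by omega
    by_cases hsmall : W.length ≤ m + 1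
    · -- then `m = 0`, `|W| = 1`, and `π` fixes the unique position
      exfalso
      have hL1 : W.length = 1 := by omega
      have hm0 : m = 0 := by omega
      apply hπ.2.1 (((finRotate W.length) ^ (m + 1)) ⟨0, hN⟩)
      apply Fin.ext
      have h1 := (π (((finRotate W.length) ^ (m + 1)) ⟨0, hN⟩)).2
      have h2 := (((finRotate W.length) ^ (m + 1)) ⟨0, hN⟩).2
      omega
    have hsk : ((((finRotate W.length) ^ (m + 1)) ⟨0, hN⟩ : Fin W.length) : ℕ) = m + 1 :=
      hck (m + 1) (by omega)
    have hletter := hπ.2.2 (((finRotate W.length) ^ (m + 1)) ⟨0, hN⟩)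
    have e1 : π (((finRotate W.length) ^ (m + 1)) ⟨0, hN⟩) = ⟨m, by omega⟩ := Fin.ext hpi
    have e2 : ((finRotate W.length) ^ (m + 1)) ⟨0, hN⟩ = ⟨m + 1, by omega⟩ := Fin.ext hsk
    rw [e1, e2] at hletter
    have h1 : (W.get ⟨m, by omega⟩).1 = (W.get ⟨m + 1, by omega⟩).1 := by
      have := congrArg Prod.fst hletter; simpa using this
    have h2 := IsReduced.get_succ hW.1 m (by omega) h1
    have h3 : (W.get ⟨m, by omega⟩).2 = !(W.get ⟨m + 1, by omega⟩).2 := by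
      have := congrArg Prod.snd hletter; simpa using this
    rw [h2] at h3
    simp at h3
  · -- `p = 2m + 1`: `π (σ^{m+1} 0) = m + 1 = σ^{m+1} 0`: a fixed point of `π`
    have hk := hval (m + 1) (by omega) (by omega)
    rw [Nat.add_sub_cancel] at hk
    have hpi : ((π (((finRotate W.length) ^ (m + 1)) ⟨0, hN⟩) : Fin W.length) : ℕ) = m + 1 := by omega
    have hsk : ((((finRotate W.length) ^ (m + 1)) ⟨0, hN⟩ : Fin W.length) : ℕ) = m + 1 :=
      hck (m + 1) (by omega)
    exact hπ.2.1 (((finRotate W.length) ^ (m + 1)) ⟨0, hN⟩) (Fin.ext (by rw [hpi, hsk]))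

end BigCorners

end Literature.GroupTheory.CombinatorialGroupTheory

end
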